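import Literature.RingTheory.MvPowerSeries.AdicTaylor
import Mathlib.Data.Nat.Choose.Basic
import HarnessLib

/-!
# Composition of divided (Hasse–Schmidt) partial derivatives of formal power series:
# `Δ_α ∘ Δ_β = C(α+β, α) · Δ_{α+β}`

Topic `Literature/RingTheory/MvPowerSeries`; companion of `AdicTaylor.lean` (which defines
`hasseDeriv α f = Δ_α f` coefficientwise, `coeff β (Δ_α f) = C(α+β, α) f_{α+β}`, Bourbaki *Alg. Comm.* III §4
no. 5 (21)) and `HasseDerivDiffOp.lean` (Leibniz rule, `Δ_α ∈ Diff^{≤|α|}`). Here: the COMPOSITION LAW of the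
iterated divided derivatives — the identity that makes `(Δ_α)_α` a Hasse–Schmidt system (an "iterative higher
derivation", Matsumura §27): for all multi-indices `α, β`,

  `Δ_α (Δ_β f) = (Π_s C(α_s + β_s, α_s)) · Δ_{α+β} f`,

in particular the `Δ_α` pairwise commute, and `Δ_{e_i}^k = k! · Δ_{k e_i}` fails to generate `Δ_{k e_i}` exactly
when `k!` is not invertible (positive characteristic) — the reason Hironaka 2017 §3 / §7 work with the full family
`∂^α` rather than with iterated first-order derivations. Everything is proved; no definitions.

## References
* H. Matsumura, *Commutative Ring Theory*, §27 (higher derivations; iterative: `D_i D_j = C(i+j, i) D_{i+j}`).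
  [Matsumura1987]
* N. Bourbaki, *Algèbre commutative* III §4 no. 5 (21). [Bourbaki1989CommAlg]
-/

noncomputable section

open MvPowerSeries

namespace Literature.RingTheory.MvPowerSeries

universe u v

variable {τ : Type u} {A : Type v} [CommRing A]

/-- The trinomial rearrangement behind the composition law, coordinatewise:
`C(a+c, a) · C(a+b+c, b) = C(a+b, a) · C(a+b+c, a+b)` (both equal the multinomial `(a+b+c)!/(a!b!c!)`).
[cite: Matsumura1987, §27 (iterative higher derivations)] -/
theorem choose_mul_choose_eq_choose_mul_choose (a b c : ℕ) :
    (a + c).choose a * (b + (a + c)).choose b = (a + b).choose a * (a + b + c).choose (a + b) := by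
  have h := Nat.choose_mul (n := a + b + c) (k := a + b) (s := b) (by omega)
  -- `h : (a+b+c).choose (a+b) * (a+b).choose b = (a+b+c).choose b * (a+b+c-b).choose (a+b-b)`
  rw [show a + b + c - b = a + c by omega, show a + b - b = a by omega] at h
  have hs : (a + b).choose b = (a + b).choose a :=
    (Nat.choose_symm_add : (a + b).choose a = (a + b).choose b).symm
  rw [show b + (a + c) = a + b + c by omega]
  calc (a + c).choose a * (a + b + c).choose b
      = (a + b + c).choose b * (a + c).choose a := mul_comm _ _
    _ = (a + b + c).choose (a + b) * (a + b).choose b := h.symm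
    _ = (a + b).choose a * (a + b + c).choose (a + b) := by rw [mul_comm, hs]

/-- **Composition of divided derivatives**: `Δ_α (Δ_β f) = (Π_s C(α_s+β_s, α_s)) · Δ_{α+β} f` (finite index type).
[cite: Matsumura1987, §27 (iterative higher derivations: D_i ∘ D_j = C(i+j,i) D_{i+j})] -/
theorem hasseDeriv_hasseDeriv [Fintype τ] (α β : τ →₀ ℕ) (f : MvPowerSeries τ A) :
    hasseDeriv α (hasseDeriv β f) = ((∏ s, (α s + β s).choose (α s) : ℕ) : A) • hasseDeriv (α + β) f := by
  ext γ
  rw [coeff_hasseDeriv, coeff_hasseDeriv, map_smul, coeff_hasseDeriv, prod_choose_eq, prod_choose_eq,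
    prod_choose_eq, smul_eq_mul, show β + (α + γ) = α + β + γ from by rw [← add_assoc, add_comm β α],
    ← mul_assoc, ← mul_assoc, ← Nat.cast_mul, ← Nat.cast_mul, ← Finset.prod_mul_distrib,
    ← Finset.prod_mul_distrib]
  congr 2
  refine Finset.prod_congr rfl fun s _ => ?_
  simp only [Finsupp.add_apply]
  rw [show β s + (α s + γ s) = α s + β s + γ s by omega]
  have h := choose_mul_choose_eq_choose_mul_choose (α s) (β s) (γ s)
  rw [show β s + (α s + γ s) = α s + β s + γ s by omega] at h
  exact h

/-- Composition law as an identity of linear maps: `Δ_α ∘ Δ_β = C(α+β, α) • Δ_{α+β}`.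
[cite: Matsumura1987, §27 (iterative higher derivations)] -/
theorem hasseDeriv_comp_hasseDeriv [Fintype τ] (α β : τ →₀ ℕ) :
    (hasseDeriv α : MvPowerSeries τ A →ₗ[A] MvPowerSeries τ A) ∘ₗ hasseDeriv β =
      ((∏ s, (α s + β s).choose (α s) : ℕ) : A) • hasseDeriv (α + β) :=
  LinearMap.ext fun f => hasseDeriv_hasseDeriv α β f

/-- The scalar is symmetric: `Π C(α_s+β_s, α_s) = Π C(β_s+α_s, β_s)`. [cite: Matsumura1987, §27] -/
theorem prod_choose_symm [Fintype τ] (α β : τ →₀ ℕ) :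
    (∏ s, (α s + β s).choose (α s)) = ∏ s, (β s + α s).choose (β s) :=
  Finset.prod_congr rfl fun s _ => by rw [Nat.choose_symm_add, add_comm]

/-- **The divided derivatives commute**: `Δ_α (Δ_β f) = Δ_β (Δ_α f)`. [cite: Matsumura1987, §27 (iterative higher
derivations)] -/
theorem hasseDeriv_comm [Fintype τ] (α β : τ →₀ ℕ) (f : MvPowerSeries τ A) :
    hasseDeriv α (hasseDeriv β f) = hasseDeriv β (hasseDeriv α f) := by
  rw [hasseDeriv_hasseDeriv, hasseDeriv_hasseDeriv, prod_choose_symm, add_comm]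

/-- Iterating a divided derivative: `Δ_α (Δ_α f) = (Π C(2α_s, α_s)) · Δ_{2α} f`. [cite: Matsumura1987, §27] -/
theorem hasseDeriv_hasseDeriv_self [Fintype τ] (α : τ →₀ ℕ) (f : MvPowerSeries τ A) :
    hasseDeriv α (hasseDeriv α f) = ((∏ s, (α s + α s).choose (α s) : ℕ) : A) • hasseDeriv (α + α) f :=
  hasseDeriv_hasseDeriv α α f

/-- **Iterated FIRST-order divided derivative in one direction**: `Δ_{e_i} (Δ_{k e_i} f) = (k+1) · Δ_{(k+1) e_i} f` —
so `Δ_{e_i}^{k} = k! · Δ_{k e_i}`, which in characteristic `p` vanishes for `k ≥ p` while `Δ_{k e_i}` does not.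
[cite: Matsumura1987, §27 (iterative higher derivations)] -/
theorem hasseDeriv_single_one_hasseDeriv_single [Fintype τ] [DecidableEq τ] (i : τ) (k : ℕ)
    (f : MvPowerSeries τ A) :
    hasseDeriv (Finsupp.single i 1) (hasseDeriv (Finsupp.single i k) f) =
      ((k + 1 : ℕ) : A) • hasseDeriv (Finsupp.single i (k + 1)) f := by
  rw [hasseDeriv_hasseDeriv, ← Finsupp.single_add, add_comm 1 k]
  congr 2
  rw [Finset.prod_eq_single i]
  · simp [Finsupp.single_eq_same, add_comm]
  · intro s _ hs
    simp [Finsupp.single_eq_of_ne hs]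
  · intro h; exact absurd (Finset.mem_univ i) h

end Literature.RingTheory.MvPowerSeries

end
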